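import Literature.NumberTheory.Transcendental.PhilipponCriterionMainLt
import Literature.NumberTheory.Transcendental.NesterenkoEliminationCor410Proofs
import HarnessLib

/-!
# Philippon's criterion over Nesterenko's toolkit, XX: the main criterion — proofs only

`Literature/NumberTheory/Transcendental/PhilipponCriterionMain.lean` — proofs only (no new
definitions, nothing asserted). The named fact `Philippon1986_mainCriterion`
(`PhilipponCriterion.lean`: Philippon 1986, Théorème 2.11, in the transcendence-degree form of
Diaz 1989) DERIVED from the named facts of LNM 1752 Ch. 3 §4 (Prop. 4.4, 4.7, Cor. 4.10, Prop. 4.11,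
Cor. 4.12, Prop. 4.13 — the elimination-theoretic toolkit, vendored in
`NesterenkoEliminationFacts.lean` / `NesterenkoEliminationFacts2.lean`):

* `l1_rename_of_injective` — the `ℓ¹`-norm is invariant under injective renaming of variables;
* `Philippon1986_mainCriterion_of_nesterenko` — the case `k < n` is `mainCriterion_of_lt`; the case
  `k = n` (where the starting prime `𝔭_{(1,θ)}` may be `(0)`) is reduced to it by the embedding
  `θ ↦ (θ, 0) ∈ ℂ^{n+1}`, `Q ↦ Q(X₁, …, X_n)` together with the extra polynomial `X_{n+1}` at every
  level (same degrees, norms, values and common zeros `× {0}`; same field `ℚ(θ, 0) = ℚ(θ)`).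

* `Philippon1986_mainCriterion_of_nesterenko'` — the same with Cor. 4.10 fed by its discharge
  `NesterenkoPhilippon2001_ch3_cor_4_10_holds` (`NesterenkoEliminationCor410Proofs.lean`): five
  facts (Prop. 4.4, 4.7, 4.11, Cor. 4.12, Prop. 4.13) remain as hypotheses.

The discharge `Philippon1986_mainCriterion_holds` is exactly this theorem applied to the discharges
of the remaining LNM facts, once those land.

## References

* [Philippon1986Criteres] P. Philippon, Publ. Math. IHÉS 64 (1986), Thm 2.11 (pp. 38–39), §3.
* [Diaz1989] G. Diaz, J. Number Theory 31 (1989), Critère p. 16.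
* [NesterenkoPhilippon2001] LNM 1752 (2001), Ch. 3 §4 (pp. 37–42).
-/

noncomputable section

open MvPolynomial Real Filter
open Literature.NumberTheory.Transcendental.Nesterenko

namespace Literature.NumberTheory.Transcendental

namespace PhilipponMain

/-- The `ℓ¹`-norm `L(Q)` is invariant under an injective renaming of the variables. [folklore] -/
theorem l1_rename_of_injective {σ τ : Type*} {f : σ → τ} (hf : Function.Injective f)
    (Q : MvPolynomial σ ℤ) : Chudnovsky.l1 (rename f Q) = Chudnovsky.l1 Q := by
  classical
  change Chudnovsky.wnorm _ (rename f Q) = Chudnovsky.wnorm _ Q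
  unfold Chudnovsky.wnorm
  rw [support_rename_of_injective hf,
    Finset.sum_image fun a _ b _ h => Finsupp.mapDomain_injective hf h]
  refine Finset.sum_congr rfl fun α _ => ?_
  rw [coeff_rename_mapDomain f hf]

end PhilipponMain

open PhilipponMain in
/-- **Philippon's main criterion (Thm 2.11, transcendence-degree form) follows from the
elimination-theoretic facts of LNM 1752 Ch. 3 §4.** The whole of §3 of Philippon's paper
(Lemmes 2.13–2.15 and the end of the proof), transplanted onto Nesterenko's invariants
`deg I`, `h(I)`, `|I(ω̄)|` (files `PhilipponCriterion*.lean`, `ProjectiveNoIsolatedPoints.lean`).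
[cite: Philippon1986Criteres, Théorème 2.11 and §3 (pp. 38–48)]
[cite: Diaz1989, Critère, p. 16]
[cite: NesterenkoPhilippon2001, Ch. 3 §4, Prop. 4.4, 4.7, Cor. 4.10, Prop. 4.11, Cor. 4.12, Prop. 4.13] -/
theorem Philippon1986_mainCriterion_of_nesterenko (h44 : NesterenkoPhilippon2001_ch3_prop_4_4)
    (h47 : NesterenkoPhilippon2001_ch3_prop_4_7) (h410 : NesterenkoPhilippon2001_ch3_cor_4_10)
    (h411 : NesterenkoPhilippon2001_ch3_prop_4_11) (h412 : NesterenkoPhilippon2001_ch3_cor_4_12)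
    (h413 : NesterenkoPhilippon2001_ch3_prop_4_13) : Philippon1986_mainCriterion := by
  classical
  intro n k θ hkn
  rcases hkn.lt_or_eq with hlt | rfl
  · exact mainCriterion_of_lt h44 h47 h410 h411 h412 h413 n k θ hlt
  -- `k = n`: embed into `ℂ^{n+1}`
  set θ' : Fin (k + 1) → ℂ := Fin.snoc θ 0 with hθ'
  obtain ⟨C, hC1, hC⟩ := mainCriterion_of_lt h44 h47 h410 h411 h412 h413 (k + 1) k θ' (Nat.lt_succ_self k)
  refine ⟨C, hC1, ?_⟩
  intro σ δ R S hσ hδ hR hS h1σ h1δ h1R h1S hτ hmono hgrowth N₀ mN Q hQ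
  have hθ'c : ∀ i : Fin k, θ' i.castSucc = θ i := fun i => by simp [hθ']
  have hθ'l : θ' (Fin.last k) = 0 := by simp [hθ']
  have hcomp : (θ' ∘ Fin.castSucc) = θ := funext hθ'c
  -- the embedded data
  set Q' : (N : ℕ) → Fin (mN N + 1) → MvPolynomial (Fin (k + 1)) ℤ := fun N =>
    Fin.snoc (fun j => rename Fin.castSucc (Q N j)) (X (Fin.last k)) with hQ'
  have hQ'c : ∀ N (j : Fin (mN N)), Q' N j.castSucc = rename Fin.castSucc (Q N j) := fun N j => by
    simp [hQ']
  have hQ'l : ∀ N, Q' N (Fin.last (mN N)) = X (Fin.last k) := fun N => by simp [hQ']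
  have h := hC σ δ R S hσ hδ hR hS h1σ h1δ h1R h1S hτ hmono hgrowth N₀ (fun N => mN N + 1) Q' ?_
  · -- `ℚ(θ, 0) = ℚ(θ)`
    have hE : IntermediateField.adjoin ℚ (Set.range θ') = IntermediateField.adjoin ℚ (Set.range θ) := by
      rw [hθ', Fin.range_snoc]
      refine le_antisymm (IntermediateField.adjoin_le_iff.mpr (Set.insert_subset_iff.mpr
        ⟨zero_mem _, IntermediateField.subset_adjoin ℚ _⟩)) (IntermediateField.adjoin.mono ℚ _ _
        (Set.subset_insert _ _))
    rwa [hE] at h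
  · intro N hN
    obtain ⟨hfin, hdeg, hl1, ⟨j₀, hj₀⟩, hsmall⟩ := hQ N hN
    refine ⟨?_, ?_, ?_, ⟨j₀.castSucc, ?_⟩, ?_⟩
    · -- common zeros `= (zeros of the Q N j) × {0}`
      refine (hfin.image fun z : Fin k → ℂ => (Fin.snoc z 0 : Fin (k + 1) → ℂ)).subset ?_
      rintro z' ⟨hz'1, hz'2⟩
      have hlast : z' (Fin.last k) = 0 := by
        have := hz'2 (Fin.last (mN N))
        rwa [hQ'l, aeval_X] at this
      refine ⟨fun i => z' i.castSucc, ⟨fun i => ?_, fun j => ?_⟩, ?_⟩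
      · have := hz'1 i.castSucc
        rwa [hθ'c] at this
      · have := hz'2 j.castSucc
        rwa [hQ'c, aeval_rename] at this
      · funext i
        refine Fin.lastCases ?_ (fun i => ?_) i
        · simp [hlast]
        · simp
    · intro j
      refine Fin.lastCases ?_ (fun j => ?_) j
      · rw [hQ'l, totalDegree_X]
        exact_mod_cast (h1δ N)
      · rw [hQ'c]
        exact le_trans (by exact_mod_cast totalDegree_rename_le _ _) (hdeg j)
    · intro j
      refine Fin.lastCases ?_ (fun j => ?_) j
      · rw [hQ'l]
        change Real.log (Chudnovsky.wnorm _ (X (Fin.last k) : MvPolynomial (Fin (k + 1)) ℤ)) ≤ σ N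
        rw [Chudnovsky.wnorm_X]
        change Real.log ‖(1 : ℤ)‖ ≤ σ N
        rw [norm_one, Real.log_one]
        linarith [h1σ N]
      · rw [hQ'c, l1_rename_of_injective (Fin.castSucc_injective k)]
        exact hl1 j
    · rwa [hQ'c, aeval_rename, hcomp]
    · intro j
      refine Fin.lastCases ?_ (fun j => ?_) j
      · rw [hQ'l, aeval_X, hθ'l, norm_zero]
        exact (exp_pos _).le
      · rw [hQ'c, aeval_rename, hcomp]
        exact hsmall j

open PhilipponMain in
/-- **Philippon's main criterion from five facts of LNM 1752 Ch. 3 §4** (Prop. 4.4, 4.7, 4.11,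
Cor. 4.12, Prop. 4.13), Cor. 4.10 being discharged in the tree
(`NesterenkoPhilippon2001_ch3_cor_4_10_holds`). [cite: Philippon1986Criteres, Théorème 2.11 and §3]
[cite: NesterenkoPhilippon2001, Ch. 3 §4] -/
theorem Philippon1986_mainCriterion_of_nesterenko' (h44 : NesterenkoPhilippon2001_ch3_prop_4_4)
    (h47 : NesterenkoPhilippon2001_ch3_prop_4_7) (h411 : NesterenkoPhilippon2001_ch3_prop_4_11)
    (h412 : NesterenkoPhilippon2001_ch3_cor_4_12) (h413 : NesterenkoPhilippon2001_ch3_prop_4_13) :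
    Philippon1986_mainCriterion :=
  Philippon1986_mainCriterion_of_nesterenko h44 h47 NesterenkoPhilippon2001_ch3_cor_4_10_holds h411
    h412 h413

end Literature.NumberTheory.Transcendental

end
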